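import Literature.Probability.RandomPlanarGeometry.SLEImageBracketEstimate
import Literature.Probability.RandomPlanarGeometry.SLEImageMartingale
import Literature.Probability.Process.LevyCharacterisationCore
import HarnessLib

/-!
# The bracket of the localised image driving function of SLE₆, III: the martingale clock ([LSW 2001] Thm. 2.2)

Conclusion of `SLEImageBracketCell` / `SLEImageBracketEstimate` (G. F. Lawler, O. Schramm, W. Werner,
Acta Math. **187** (2001), Thm. 2.2; [LSW] 2003 §5, remark after (5.1): **at `κ = 6` the image driving
value `W̃_t = h_t(W_t)` is a continuous local martingale with bracket `6 ∫₀ᵗ h_s'(W_s)² ds`**). Summing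
the cell estimate `abs_setIntegral_imgBracketCell_le` over a uniform partition of `[s, t]`, letting the mesh
and then the oscillation threshold go to `0` (`setIntegral_imgBracket_sub_eq_zero`), the compensated square
`(Mⁿ)² − 6 · imgClockK 6 hA hne n` of the stopped image driving process `Mⁿ = imgMartK 6 hA hne n` is an
`𝓕`-martingale (`martingale_imgBracket`); together with `martingale_imgMartK` (`SLEImageMartingale`):
**`Mⁿ/√6` carries the martingale clock `imgClockK` in the sense of `Process.HasMartingaleClock`**
(`hasMartingaleClock_imgMartK`) — the input of the Dambis–Dubins–Schwarz time change.

## References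

* G. F. Lawler, O. Schramm, W. Werner, Acta Math. **187** (2001), Thm. 2.2. [LawlerSchrammWerner2001]
* [LSW] 2003, §5 (remark after (5.1)). [LawlerSchrammWerner2003Restriction]
-/

noncomputable section

open Set Filter Metric Function MeasureTheory ProbabilityTheory
open _root_.Complex _root_.Topology
open Literature.Probability.Process (brownian preWienerMeasure runSup)
open scoped NNReal

namespace Literature.Probability.RandomPlanarGeometry

open Loewner PathOps

variable {A : Set ℂ} {hA : IsStarHull A} {hne : A.Nonempty} {n : ℕ}

/-! ### Telescoping over a partition -/

section Partition

variable [MeasurableSpace C(ℝ≥0, ℝ)] [BorelSpace C(ℝ≥0, ℝ)]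

/-- **Summing the bracket cell estimates over a uniform partition of `[s, t]` into `N` cells of length `h`**
(`t ≤ t₁`). [folklore] -/
theorem abs_setIntegral_imgBracket_sub_le_of_partition (hA : IsStarHull A) (hne : A.Nonempty) {R : ℝ} (hR0 : 0 < R)
    (hAR : A ⊆ closedBall (0 : ℂ) R) {t₁ : ℝ≥0} {C : ℝ}
    (hC : ∀ (u h : ℝ≥0), u ≤ t₁ → 0 < h → 192 * (h : ℝ) ≤ (locLevel n * (locLevel n / 8) / 4000) ^ 2 →
      ∀ {g : (ℝ≥0 → ℝ) → ℝ}, Measurable[brownianFiltration u] g → (∀ ω, g ω ∈ Icc (0 : ℝ) 1) →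
        (∀ ω, g ω ≠ 0 → Disjoint (closedHull (drvK 6 (brownianCPath ω)) u) A ∧
          Disjoint (ball (0 : ℂ) (8 * (locLevel n / 8))) (slidHull (drvK 6 (brownianCPath ω)) A u) ∧
            locLevel n ≤ starDeriv (slidHull (drvK 6 (brownianCPath ω)) A u)) →
        |∫ ω, g ω * (imageDrvFnK 6 A (u + h) (brownianCPath ω) - imageDrvFnK 6 A u (brownianCPath ω)) ∂preWienerMeasure| ≤
          C * h * Real.sqrt h ∧
        |∫ ω, g ω * ((imageDrvFnK 6 A (u + h) (brownianCPath ω) - imageDrvFnK 6 A u (brownianCPath ω)) ^ 2 -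
            6 * starDeriv (slidHull (drvK 6 (brownianCPath ω)) A u) ^ 2 * h) ∂preWienerMeasure| ≤ C * h * Real.sqrt h)
    {s t : ℝ≥0} (hst : s ≤ t) (ht₁ : t ≤ t₁) {S : Set (ℝ≥0 → ℝ)} (hS : MeasurableSet[brownianFiltration s] S)
    {κ₀ : ℝ} (hκ₀ : 0 < κ₀) {N : ℕ} {h : ℝ≥0} (hhN : (N : ℝ≥0) * h = t - s) (hh0 : 0 < h) (hh1 : (h : ℝ) ≤ 1)
    (hhc : 192 * (h : ℝ) ≤ (locLevel n * (locLevel n / 8) / 4000) ^ 2)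
    (hh2 : stepSize κ₀ h ≤ locLevel n * (locLevel n / 16) / 1000) :
    |∫ ω in S, ((imgMartK 6 hA hne n t ω ^ 2 - 6 * imgClockK 6 hA hne n t ω) -
        (imgMartK 6 hA hne n s ω ^ 2 - 6 * imgClockK 6 hA hne n s ω)) ∂preWienerMeasure| ≤
      N * ((1 + 6 * (((n : ℝ) + 1) + 1160 * (3 * ((n : ℝ) + 1) + 13 * Real.sqrt ((n : ℝ) + 1) + R))) * (C * h * Real.sqrt h)) +
        ((50 * (h : ℝ) / (locLevel n / 16) + 4 * κ₀) ^ 2 +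
          2 * (((n : ℝ) + 1) + 1160 * (3 * ((n : ℝ) + 1) + 13 * Real.sqrt ((n : ℝ) + 1) + R)) *
            (50 * (h : ℝ) / (locLevel n / 16) + 4 * κ₀) + 6 * (h : ℝ)) +
        N * (12 * h * cellErr n κ₀ h) +
        N * ((((8 * (((n : ℝ) + 1) + 1160 * (3 * ((n : ℝ) + 1) + 13 * Real.sqrt ((n : ℝ) + 1) + R)) ^ 2 +
            2 * (15080 * Real.sqrt ((t₁ : ℝ) + 1) + 1160 * R) ^ 2 +
            2 * (((n : ℝ) + 1) + 1160 * (3 * ((n : ℝ) + 1) + 13 * Real.sqrt ((n : ℝ) + 1) + R)) *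
              (15080 * Real.sqrt ((t₁ : ℝ) + 1) + 1160 * R) + 12) +
            (2 * (((n : ℝ) + 1) + 1160 * (3 * ((n : ℝ) + 1) + 13 * Real.sqrt ((n : ℝ) + 1) + R)) * (3482 * Real.sqrt 6) +
              4 * (15080 * Real.sqrt ((t₁ : ℝ) + 1) + 1160 * R) * (3482 * Real.sqrt 6)) +
            (2 * (3482 * Real.sqrt 6) ^ 2)) * (768 / (κ₀ / Real.sqrt 6) ^ 8) +
          ((2 * (((n : ℝ) + 1) + 1160 * (3 * ((n : ℝ) + 1) + 13 * Real.sqrt ((n : ℝ) + 1) + R)) * (3482 * Real.sqrt 6) +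
              4 * (15080 * Real.sqrt ((t₁ : ℝ) + 1) + 1160 * R) * (3482 * Real.sqrt 6)) +
            (2 * (3482 * Real.sqrt 6) ^ 2)) * (18 * ((t₁ : ℝ) + 1) ^ 2)) * (h : ℝ) ^ 2) := by
  haveI := isProbabilityMeasure_preWienerMeasure'
  have hc0 := (locLevel_pos_le n).1
  have hSm : MeasurableSet S := brownianFiltration.le s _ hS
  set Z : ℝ≥0 → (ℝ≥0 → ℝ) → ℝ := fun r ω ↦ imgMartK 6 hA hne n r ω ^ 2 - 6 * imgClockK 6 hA hne n r ω with hZ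
  set N₀ : ℝ := ((n : ℝ) + 1) + 1160 * (3 * ((n : ℝ) + 1) + 13 * Real.sqrt ((n : ℝ) + 1) + R) with hN₀
  set D : ℝ := 50 * (h : ℝ) / (locLevel n / 16) + 4 * κ₀ with hD
  set K : ℝ := (((8 * N₀ ^ 2 + 2 * (15080 * Real.sqrt ((t₁ : ℝ) + 1) + 1160 * R) ^ 2 +
      2 * N₀ * (15080 * Real.sqrt ((t₁ : ℝ) + 1) + 1160 * R) + 12) +
      (2 * N₀ * (3482 * Real.sqrt 6) + 4 * (15080 * Real.sqrt ((t₁ : ℝ) + 1) + 1160 * R) * (3482 * Real.sqrt 6)) +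
      (2 * (3482 * Real.sqrt 6) ^ 2)) * (768 / (κ₀ / Real.sqrt 6) ^ 8) +
    ((2 * N₀ * (3482 * Real.sqrt 6) + 4 * (15080 * Real.sqrt ((t₁ : ℝ) + 1) + 1160 * R) * (3482 * Real.sqrt 6)) +
      (2 * (3482 * Real.sqrt 6) ^ 2)) * (18 * ((t₁ : ℝ) + 1) ^ 2)) with hK
  set Dv : ℝ := D ^ 2 + 2 * N₀ * D + 6 * (h : ℝ) with hDv
  have hN₀0 : 0 ≤ N₀ := by positivity
  have hDv0 : 0 ≤ Dv := by positivity
  set u : ℕ → ℝ≥0 := fun i ↦ s + (i : ℝ≥0) * h with hu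
  have hu0 : u 0 = s := by simp [hu]
  have huN : u N = t := by rw [hu]; simp only; rw [hhN, add_tsub_cancel_of_le hst]
  have husucc : ∀ i, u (i + 1) = u i + h := fun i ↦ by simp only [hu]; push_cast; ring
  have hsu : ∀ i, s ≤ u i := fun i ↦ by simp only [hu]; exact le_self_add
  have hut : ∀ i, i < N → u i ≤ t₁ := fun i hi ↦ by
    refine le_trans ?_ ht₁
    rw [← huN]; simp only [hu]
    gcongr
  -- telescoping
  have hint : ∀ i, Integrable (Z (u i)) preWienerMeasure := fun i ↦
    (integrable_imgMartK_sq n _).sub ((integrable_imgClockK (κ := 6) (hA := hA) (hne := hne) n _).2.const_mul 6)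
  have htel : ∫ ω in S, (Z t ω - Z s ω) ∂preWienerMeasure =
      ∑ i ∈ Finset.range N, ∫ ω in S, (Z (u (i + 1)) ω - Z (u i) ω) ∂preWienerMeasure := by
    have e1 : (fun ω ↦ Z t ω - Z s ω) = fun ω ↦ ∑ i ∈ Finset.range N, (Z (u (i + 1)) ω - Z (u i) ω) := by
      funext ω; rw [Finset.sum_range_sub (fun i ↦ Z (u i) ω), huN, hu0]
    have hint' : ∀ i ∈ Finset.range N, Integrable (fun ω ↦ Z (u (i + 1)) ω - Z (u i) ω) (preWienerMeasure.restrict S) :=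
      fun i _ ↦ ((hint (i + 1)).sub (hint i)).integrableOn
    rw [e1]
    exact integral_finsetSum (Finset.range N) (f := fun i ω ↦ Z (u (i + 1)) ω - Z (u i) ω) hint'
  rw [htel]
  -- the boundary events are pairwise disjoint
  set E : ℕ → Set (ℝ≥0 → ℝ) := fun i ↦ {ω | ((u i : ℝ≥0) : WithTop ℝ≥0) < imgLocTimeK 6 hA hne n ω ∧
    imgLocTimeK 6 hA hne n ω < ((u i + h : ℝ≥0) : WithTop ℝ≥0)} with hE
  have hEm : ∀ i, MeasurableSet (E i) := fun i ↦ by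
    obtain ⟨-, h1, h2⟩ := measurableSet_lt_imgLocTimeK (κ := 6) (hA := hA) (hne := hne) n (u i) (u i + h)
    exact h1.inter h2
  have hdisj : Set.PairwiseDisjoint (↑(Finset.range N) : Set ℕ) E := by
    intro i _ j _ hij
    rw [Function.onFun, Set.disjoint_left]
    rintro ω ⟨hi1, hi2⟩ ⟨hj1, hj2⟩
    have hh0' : (0 : ℝ) < h := hh0
    have hji : u j < u i + h := by have := hj1.trans hi2; exact_mod_cast this
    have hij' : u i < u j + h := by have := hi1.trans hj2; exact_mod_cast this
    have hji_r : (s : ℝ) + j * h < s + i * h + h := by have := hji; simp only [hu] at this; exact_mod_cast this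
    have hij_r : (s : ℝ) + i * h < s + j * h + h := by have := hij'; simp only [hu] at this; exact_mod_cast this
    rcases lt_or_gt_of_ne hij with hlt | hlt
    · have : (i : ℝ) + 1 ≤ j := by exact_mod_cast hlt
      nlinarith
    · have : (j : ℝ) + 1 ≤ i := by exact_mod_cast hlt
      nlinarith
  have hsumE : ∑ i ∈ Finset.range N, preWienerMeasure.real (E i) ≤ 1 := by
    have := sum_measureReal_le_measureReal_univ (μ := preWienerMeasure) (s := Finset.range N) (fun i _ ↦ hEm i) hdisj
    rwa [probReal_univ] at this
  -- sum the cell estimates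
  have hcell : ∀ i ∈ Finset.range N, |∫ ω in S, (Z (u (i + 1)) ω - Z (u i) ω) ∂preWienerMeasure| ≤
      (1 + 6 * N₀) * (C * h * Real.sqrt h) + Dv * preWienerMeasure.real (E i) + 12 * h * cellErr n κ₀ h + K * (h : ℝ) ^ 2 :=
    fun i hi ↦ by
    rw [husucc]
    exact abs_setIntegral_imgBracketCell_le hA hne hR0 hAR hC (hsu i) (hut i (Finset.mem_range.1 hi)) hS hκ₀ hh0 hh1 hhc hh2
  calc |∑ i ∈ Finset.range N, ∫ ω in S, (Z (u (i + 1)) ω - Z (u i) ω) ∂preWienerMeasure|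
      ≤ ∑ i ∈ Finset.range N, |∫ ω in S, (Z (u (i + 1)) ω - Z (u i) ω) ∂preWienerMeasure| := Finset.abs_sum_le_sum_abs _ _
    _ ≤ ∑ i ∈ Finset.range N, ((1 + 6 * N₀) * (C * h * Real.sqrt h) + Dv * preWienerMeasure.real (E i) + 12 * h * cellErr n κ₀ h +
          K * (h : ℝ) ^ 2) := Finset.sum_le_sum hcell
    _ = N * ((1 + 6 * N₀) * (C * h * Real.sqrt h)) + Dv * ∑ i ∈ Finset.range N, preWienerMeasure.real (E i) +
          N * (12 * h * cellErr n κ₀ h) + N * (K * (h : ℝ) ^ 2) := by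
        rw [Finset.sum_add_distrib, Finset.sum_add_distrib, Finset.sum_add_distrib, Finset.sum_const, Finset.sum_const,
          Finset.sum_const, Finset.card_range, ← Finset.mul_sum]
        simp [nsmul_eq_mul]
    _ ≤ _ := by
        have := mul_le_mul_of_nonneg_left hsumE hDv0
        linarith

end Partition

/-! ### The increments of the compensated square integrate to zero over `𝓕_s`-events -/

section Zero

/-- **`∫_S (Zⁿ_t − Zⁿ_s) = 0` for `s ≤ t`, `S ∈ 𝓕_s`, `Zⁿ = (Mⁿ)² − 6 imgClockK`** (mesh `→ 0`, then `κ₀ → 0`).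
[cite: LawlerSchrammWerner2001, Thm. 2.2] -/
theorem setIntegral_imgBracket_sub_eq_zero {s t : ℝ≥0} (hst : s ≤ t) {S : Set (ℝ≥0 → ℝ)}
    (hS : MeasurableSet[brownianFiltration s] S) :
    ∫ ω in S, ((imgMartK 6 hA hne n t ω ^ 2 - 6 * imgClockK 6 hA hne n t ω) -
        (imgMartK 6 hA hne n s ω ^ 2 - 6 * imgClockK 6 hA hne n s ω)) ∂preWienerMeasure = 0 := by
  letI : MeasurableSpace C(ℝ≥0, ℝ) := borel _
  haveI : BorelSpace C(ℝ≥0, ℝ) := ⟨rfl⟩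
  rcases hst.eq_or_lt with heq | hst'
  · subst heq; simp
  obtain ⟨hc0, hc1⟩ := locLevel_pos_le n
  set c := locLevel n with hc
  obtain ⟨R₁, hR₁⟩ := hA.isBoundedHull.isCompact.isBounded.subset_closedBall (0 : ℂ)
  set R : ℝ := max R₁ 1 with hR
  have hR0 : 0 < R := lt_max_of_lt_right one_pos
  have hAR : A ⊆ closedBall (0 : ℂ) R := hR₁.trans (closedBall_subset_closedBall (le_max_left _ _))
  have hρ₀ : 0 < c / 8 := by positivity
  have hρ1 : c / 8 ≤ 1 := by linarith
  obtain ⟨C, hC0, hC⟩ := exists_abs_integral_mul_imageDrv_sub_le hA hne hρ₀ hρ1 hc0 hc1 (measurable_imageDrvFnK 6 hA hne) t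
  set N₀ : ℝ := ((n : ℝ) + 1) + 1160 * (3 * ((n : ℝ) + 1) + 13 * Real.sqrt ((n : ℝ) + 1) + R) with hN₀
  have hN₀0 : 0 ≤ N₀ := by positivity
  set I : ℝ := ∫ ω in S, ((imgMartK 6 hA hne n t ω ^ 2 - 6 * imgClockK 6 hA hne n t ω) -
      (imgMartK 6 hA hne n s ω ^ 2 - 6 * imgClockK 6 hA hne n s ω)) ∂preWienerMeasure with hI
  have hts : (0 : ℝ) < (t : ℝ) - s := by have : (s : ℝ) < t := (by exact_mod_cast hst'); linarith
  -- the mesh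
  set hN : ℕ → ℝ≥0 := fun N ↦ (t - s) / ((N : ℝ≥0) + 1) with hhN
  have hhN' : ∀ N : ℕ, (((N + 1 : ℕ) : ℝ≥0)) * hN N = t - s := fun N ↦ by
    simp only [hhN]; push_cast; rw [mul_div_cancel₀ _ (by positivity)]
  have hcoe : ∀ N : ℕ, (hN N : ℝ) = ((t : ℝ) - s) / ((N : ℝ) + 1) := fun N ↦ by
    simp only [hhN]; push_cast [NNReal.coe_sub hst]; ring
  have hh_pos : ∀ N, 0 < hN N := fun N ↦ by
    have : (0 : ℝ) < hN N := by rw [hcoe]; positivity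
    exact_mod_cast this
  have hh_tend : Tendsto (fun N ↦ (hN N : ℝ)) atTop (𝓝 0) := by
    simp_rw [hcoe]
    exact tendsto_const_nhds.div_atTop (tendsto_natCast_atTop_atTop.atTop_add tendsto_const_nhds)
  have hsqrt_tend : Tendsto (fun N ↦ Real.sqrt (hN N)) atTop (𝓝 0) := by
    have := (Real.continuous_sqrt.tendsto 0).comp hh_tend
    rwa [Function.comp_def, Real.sqrt_zero] at this
  have hNh : ∀ N : ℕ, ((N + 1 : ℕ) : ℝ) * (hN N : ℝ) = (t : ℝ) - s := fun N ↦ by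
    rw [hcoe]; push_cast; field_simp
  -- Step 1: for every small `κ₀ > 0`, `|I| ≤ L(κ₀) = 16κ₀² + 8N₀κ₀ + 12(t−s)·(32κ₀/c)`
  have step1 : ∀ κ₀ : ℝ, 0 < κ₀ → κ₀ ≤ c * (c / 16) / 2000 →
      |I| ≤ (4 * κ₀) ^ 2 + 2 * N₀ * (4 * κ₀) + 12 * ((t : ℝ) - s) * (2 * κ₀ / (c / 16)) := by
    intro κ₀ hκ₀ hκc
    set K : ℝ := (((8 * N₀ ^ 2 + 2 * (15080 * Real.sqrt ((t : ℝ) + 1) + 1160 * R) ^ 2 +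
        2 * N₀ * (15080 * Real.sqrt ((t : ℝ) + 1) + 1160 * R) + 12) +
        (2 * N₀ * (3482 * Real.sqrt 6) + 4 * (15080 * Real.sqrt ((t : ℝ) + 1) + 1160 * R) * (3482 * Real.sqrt 6)) +
        (2 * (3482 * Real.sqrt 6) ^ 2)) * (768 / (κ₀ / Real.sqrt 6) ^ 8) +
      ((2 * N₀ * (3482 * Real.sqrt 6) + 4 * (15080 * Real.sqrt ((t : ℝ) + 1) + 1160 * R) * (3482 * Real.sqrt 6)) +
        (2 * (3482 * Real.sqrt 6) ^ 2)) * (18 * ((t : ℝ) + 1) ^ 2)) with hK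
    set RHS : ℕ → ℝ := fun N ↦ ((N + 1 : ℕ) : ℝ) * ((1 + 6 * N₀) * (C * hN N * Real.sqrt (hN N))) +
        ((50 * (hN N : ℝ) / (c / 16) + 4 * κ₀) ^ 2 + 2 * N₀ * (50 * (hN N : ℝ) / (c / 16) + 4 * κ₀) + 6 * (hN N : ℝ)) +
        ((N + 1 : ℕ) : ℝ) * (12 * hN N * cellErr n κ₀ (hN N)) + ((N + 1 : ℕ) : ℝ) * (K * (hN N : ℝ) ^ 2) with hRHS
    have hRHS_eq : ∀ N, RHS N = (1 + 6 * N₀) * C * ((t : ℝ) - s) * Real.sqrt (hN N) +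
        ((50 * (hN N : ℝ) / (c / 16) + 4 * κ₀) ^ 2 + 2 * N₀ * (50 * (hN N : ℝ) / (c / 16) + 4 * κ₀) + 6 * (hN N : ℝ)) +
        12 * ((t : ℝ) - s) * cellErr n κ₀ (hN N) + K * ((t : ℝ) - s) * (hN N : ℝ) := fun N ↦ by
      simp only [hRHS]
      have e := hNh N
      have e1 : ((N + 1 : ℕ) : ℝ) * ((1 + 6 * N₀) * (C * hN N * Real.sqrt (hN N))) =
          (1 + 6 * N₀) * C * (((N + 1 : ℕ) : ℝ) * hN N) * Real.sqrt (hN N) := by ring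
      have e2 : ((N + 1 : ℕ) : ℝ) * (12 * hN N * cellErr n κ₀ (hN N)) = 12 * (((N + 1 : ℕ) : ℝ) * hN N) * cellErr n κ₀ (hN N) := by ring
      have e3 : ((N + 1 : ℕ) : ℝ) * (K * (hN N : ℝ) ^ 2) = K * (((N + 1 : ℕ) : ℝ) * hN N) * hN N := by ring
      rw [e1, e2, e3, e]
    have hce : Tendsto (fun N ↦ cellErr n κ₀ (hN N)) atTop (𝓝 (50 * 0 / (c / 16) ^ 2 + 2 * (κ₀ + 4 * 0) / (c / 16))) := by
      have : (fun N ↦ cellErr n κ₀ (hN N)) = fun N ↦ 50 * (hN N : ℝ) / (c / 16) ^ 2 + 2 * (κ₀ + 4 * Real.sqrt (hN N)) / (c / 16) := by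
        funext N; rw [cellErr, stepSize]
      rw [this]
      exact ((tendsto_const_nhds.mul hh_tend).div_const _).add
        ((tendsto_const_nhds.mul (tendsto_const_nhds.add (tendsto_const_nhds.mul hsqrt_tend))).div_const _)
    rw [mul_zero, zero_div, zero_add, mul_zero, add_zero] at hce
    have hlim : Tendsto RHS atTop (𝓝 ((4 * κ₀) ^ 2 + 2 * N₀ * (4 * κ₀) + 12 * ((t : ℝ) - s) * (2 * κ₀ / (c / 16)))) := by
      have h1 : Tendsto (fun N ↦ (1 + 6 * N₀) * C * ((t : ℝ) - s) * Real.sqrt (hN N)) atTop (𝓝 0) := by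
        have := tendsto_const_nhds (x := (1 + 6 * N₀) * C * ((t : ℝ) - s)) |>.mul hsqrt_tend
        rwa [mul_zero] at this
      have h2 : Tendsto (fun N ↦ (50 * (hN N : ℝ) / (c / 16) + 4 * κ₀) ^ 2 + 2 * N₀ * (50 * (hN N : ℝ) / (c / 16) + 4 * κ₀) +
          6 * (hN N : ℝ)) atTop (𝓝 ((50 * 0 / (c / 16) + 4 * κ₀) ^ 2 + 2 * N₀ * (50 * 0 / (c / 16) + 4 * κ₀) + 6 * 0)) := by
        have hd : Tendsto (fun N ↦ 50 * (hN N : ℝ) / (c / 16) + 4 * κ₀) atTop (𝓝 (50 * 0 / (c / 16) + 4 * κ₀)) :=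
          ((tendsto_const_nhds.mul hh_tend).div_const _).add tendsto_const_nhds
        exact ((hd.pow 2).add (tendsto_const_nhds.mul hd)).add (tendsto_const_nhds.mul hh_tend)
      rw [mul_zero, zero_div, zero_add, mul_zero, add_zero] at h2
      have h3 : Tendsto (fun N ↦ 12 * ((t : ℝ) - s) * cellErr n κ₀ (hN N)) atTop (𝓝 (12 * ((t : ℝ) - s) * (2 * κ₀ / (c / 16)))) :=
        tendsto_const_nhds.mul hce
      have h4 : Tendsto (fun N ↦ K * ((t : ℝ) - s) * (hN N : ℝ)) atTop (𝓝 0) := by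
        have := tendsto_const_nhds (x := K * ((t : ℝ) - s)) |>.mul hh_tend
        rwa [mul_zero] at this
      have := ((h1.add h2).add h3).add h4
      rw [zero_add, add_zero] at this
      exact this.congr fun N ↦ (hRHS_eq N).symm
    have hK1 : (0 : ℝ) < (c * (c / 8) / 4000) ^ 2 / 192 := by positivity
    have hK2 : (0 : ℝ) < c * (c / 16) / 8000 := by positivity
    have hev : ∀ᶠ N in atTop, |I| ≤ RHS N := by
      filter_upwards [hh_tend.eventually (eventually_le_nhds hK1), hh_tend.eventually (eventually_le_nhds one_pos),
        hsqrt_tend.eventually (eventually_le_nhds hK2)] with N h1 h1' h2b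
      have hhc : 192 * (hN N : ℝ) ≤ (c * (c / 8) / 4000) ^ 2 := by
        have := mul_le_mul_of_nonneg_left h1 (by norm_num : (0 : ℝ) ≤ 192)
        rwa [mul_div_cancel₀ _ (by norm_num : (192 : ℝ) ≠ 0)] at this
      have hh2 : stepSize κ₀ (hN N) ≤ c * (c / 16) / 1000 := by rw [stepSize]; linarith
      exact abs_setIntegral_imgBracket_sub_le_of_partition (n := n) hA hne hR0 hAR hC hst le_rfl hS hκ₀ (N := N + 1) (hhN' N)
        (hh_pos N) h1' hhc hh2
    exact ge_of_tendsto hlim hev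
  -- Step 2: `κ₀ → 0`
  have hL : Tendsto (fun κ₀ : ℝ ↦ (4 * κ₀) ^ 2 + 2 * N₀ * (4 * κ₀) + 12 * ((t : ℝ) - s) * (2 * κ₀ / (c / 16))) (𝓝[>] 0) (𝓝 0) := by
    have h1 : Tendsto (fun κ₀ : ℝ ↦ (4 * κ₀) ^ 2 + 2 * N₀ * (4 * κ₀) + 12 * ((t : ℝ) - s) * (2 * κ₀ / (c / 16))) (𝓝 0)
        (𝓝 ((4 * 0) ^ 2 + 2 * N₀ * (4 * 0) + 12 * ((t : ℝ) - s) * (2 * 0 / (c / 16)))) := by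
      have hk : Tendsto (fun κ₀ : ℝ ↦ κ₀) (𝓝 0) (𝓝 0) := tendsto_id
      exact (((tendsto_const_nhds.mul hk).pow 2).add (tendsto_const_nhds.mul (tendsto_const_nhds.mul hk))).add
        (tendsto_const_nhds.mul ((tendsto_const_nhds.mul hk).div_const _))
    rw [mul_zero, zero_pow two_ne_zero, mul_zero, mul_zero, zero_div, mul_zero, add_zero, add_zero] at h1
    exact h1.mono_left nhdsWithin_le_nhds
  have hevκ : ∀ᶠ κ₀ in 𝓝[>] (0 : ℝ), |I| ≤ (4 * κ₀) ^ 2 + 2 * N₀ * (4 * κ₀) + 12 * ((t : ℝ) - s) * (2 * κ₀ / (c / 16)) := by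
    have hpos : ∀ᶠ κ₀ in 𝓝[>] (0 : ℝ), 0 < κ₀ := eventually_mem_nhdsWithin
    have hsmall : ∀ᶠ κ₀ in 𝓝[>] (0 : ℝ), κ₀ ≤ c * (c / 16) / 2000 :=
      (eventually_le_nhds (by positivity : (0 : ℝ) < c * (c / 16) / 2000)).filter_mono nhdsWithin_le_nhds
    filter_upwards [hpos, hsmall] with κ₀ h1 h2
    exact step1 κ₀ h1 h2
  exact abs_nonpos_iff.1 (ge_of_tendsto hL hevκ)

end Zero

/-! ### The martingale clock -/

section Clock

/-- **The compensated square `(Mⁿ)² − 6 · imgClockK` is an `𝓕`-martingale** ([LSW 2001] Thm. 2.2 at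
`κ = 6`: the bracket of `W̃` is `6 ∫ h_s'(W_s)² ds`). [cite: LawlerSchrammWerner2001, Thm. 2.2] -/
theorem martingale_imgBracket :
    Martingale (fun t ω ↦ imgMartK 6 hA hne n t ω ^ 2 - 6 * imgClockK 6 hA hne n t ω) brownianFiltration preWienerMeasure := by
  haveI := isProbabilityMeasure_preWienerMeasure'
  have had : StronglyAdapted brownianFiltration (fun t ω ↦ imgMartK 6 hA hne n t ω ^ 2 - 6 * imgClockK 6 hA hne n t ω) := fun t ↦
    (((stronglyAdapted_imgMartK (κ := 6) (hA := hA) (hne := hne) n) t).pow 2).sub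
      ((adapted_imgClockK (κ := 6) (hA := hA) (hne := hne) n t).const_mul 6).stronglyMeasurable
  have hint : ∀ t, Integrable (fun ω ↦ imgMartK 6 hA hne n t ω ^ 2 - 6 * imgClockK 6 hA hne n t ω) preWienerMeasure := fun t ↦
    (integrable_imgMartK_sq n _).sub ((integrable_imgClockK (κ := 6) (hA := hA) (hne := hne) n _).2.const_mul 6)
  refine ⟨had, fun i j hij ↦ ?_⟩
  have hm : brownianFiltration i ≤ (inferInstance : MeasurableSpace (ℝ≥0 → ℝ)) := brownianFiltration.le i
  haveI : IsFiniteMeasure (preWienerMeasure.trim hm) := isFiniteMeasure_trim hm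
  refine (ae_eq_condExp_of_forall_setIntegral_eq hm (hint j) (fun S _ _ ↦ (hint i).integrableOn) (fun S hS _ ↦ ?_)
    ((had i).aestronglyMeasurable)).symm
  have h0 := setIntegral_imgBracket_sub_eq_zero (hA := hA) (hne := hne) (n := n) hij hS
  rw [integral_sub (hint j).integrableOn (hint i).integrableOn, sub_eq_zero] at h0
  exact h0.symm

/-- **`Mⁿ/√6` carries the martingale clock `imgClockK n`** (`Process.HasMartingaleClock`): `Mⁿ/√6` and
`(Mⁿ/√6)² − imgClockK` are (a.e.) martingales, the clock starts at `0`, is nondecreasing and `1`-Lipschitz,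
and `Mⁿ/√6` is bounded — the input of the Dambis–Dubins–Schwarz time change `HasMartingaleClock.timeChange`.
[cite: LawlerSchrammWerner2001, Thm. 2.2] -/
theorem hasMartingaleClock_imgMartK (hA : IsStarHull A) (hne : A.Nonempty) (n : ℕ) :
    ∃ N : ℝ, Process.HasMartingaleClock (fun t ω ↦ (Real.sqrt 6)⁻¹ * imgMartK 6 hA hne n t ω) (imgClockK 6 hA hne n)
      brownianFiltration preWienerMeasure N := by
  obtain ⟨N', -, hN'⟩ := exists_forall_abs_imgMartK_le (κ := 6) hA hne n
  have h6 : (0 : ℝ) < Real.sqrt 6 := Real.sqrt_pos.2 (by norm_num)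
  refine ⟨(Real.sqrt 6)⁻¹ * N', ?_⟩
  have hsq : ((Real.sqrt 6)⁻¹) ^ 2 = (6 : ℝ)⁻¹ := by rw [inv_pow, Real.sq_sqrt (by norm_num)]
  exact
    { isAEMartingale := (isAEMartingale_imgMartK (hA := hA) (hne := hne) (n := n)).const_mul _
      isAEMartingale_sq_sub := by
        have h1 := (martingale_imgBracket (hA := hA) (hne := hne) (n := n)).isAEMartingale.const_mul ((6 : ℝ)⁻¹)
        refine h1.congr fun t ↦ Eventually.of_forall fun ω ↦ ?_
        show (6 : ℝ)⁻¹ * (imgMartK 6 hA hne n t ω ^ 2 - 6 * imgClockK 6 hA hne n t ω) =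
          ((Real.sqrt 6)⁻¹ * imgMartK 6 hA hne n t ω) ^ 2 - imgClockK 6 hA hne n t ω
        rw [mul_pow, hsq]; field_simp
      clock_zero := fun ω ↦ imgClockK_zero n ω
      clock_mono := fun ω s t hst ↦ imgClockK_mono n ω hst
      clock_sub_le := fun ω s t hst ↦ imgClockK_sub_le hst ω
      abs_le := Eventually.of_forall fun ω t ↦ by
        rw [abs_mul, abs_of_pos (inv_pos.2 h6)]
        exact mul_le_mul_of_nonneg_left (hN' t ω) (inv_pos.2 h6).le }

end Clock

end Literature.Probability.RandomPlanarGeometry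

end
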